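import Summits.ResolutionOfSingularities.ResolutionOfSingularities.Theorems.FrobeniusLadderFInjectiveMacaulayficationSegreConeFull
import HarnessLib

/-!
# (T-instance #7 scoping, kernel brick K1) A hypersurface with a SQUARE-FREE CUBIC TERM in isolated variables is FULL at every closed point, every prime `p`
# (crux `FInjectiveMacaulayfication` stmt-ResolutionOfSingularities-15315, chain w45a; res-L1-w45a-plan-1 R23.26 (1) «(C1) scoping: FULL along the curve by
# chart Fedder (non-vacuity)»; memo `Cruxes/…/Lines/T-instance7-C1.md` §4; seat res-L1-w45a-lead-1 g13)

[OURS · L1 W4.5a] Support file (`--supports stmt-ResolutionOfSingularities-15315 --as helper`); def-free; UNCONDITIONAL; no named fact; NOT a statement of any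
manuscript. A FULLness tool (the three-variable twin of ✓`SegreConeFull.clause_binomial`); evidence for nothing beyond itself; T″ and the F-half OPEN; nothing of
the crux proved. AI-written (AI review is weaker than expert review).

Fedder at a prime `𝔫 = (a₁,…,a_m) ∋ g` for `g = X_aX_bX_c + W` with `∂_aW = ∂_bW = ∂_cW = 0` (`a, b, c` distinct): if `g^{p−1} ∈ (aᵢ^p) =: I`
(derivation-stable) then `∂_a^{p−1}` leaves `(p−1)!·(X_bX_c)^{p−1}`, `∂_b^{p−1}` leaves `(p−1)!²·X_c^{p−1}`, `∂_c^{p−1}` leaves `(p−1)!³ ∈ I ⊆ 𝔫` — a unit. So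
`k[X₀..X₄]/(g)` passes Fedder's test at EVERY maximal ideal, in EVERY characteristic: the crux's FULL clause (CM ∧ parameter ideals Frobenius closed) holds at
every closed point (✓`FedderAtMaximalIdeal.stub_fedderAtMaximalIdeal`).
* `g_pow_eq_sum`, ★ `iterate_pderiv_g_pow` (`∂_a^{p−1}(g^{p−1}) = (p−1)!·(X_bX_c)^{p−1}`), ★★ `pow_not_mem_span_pow_cubic`, ★★ `clause_cubic`, `fullCl_stalk_cubic`
  (given `g` prime);
* the (C1)-bed models of `Lines/T-instance7-C1.md`: `clause_tangentCone` — the tangent cone `C = {X₀X₁X₂ + X₃²X₄ = 0}` of the bed; `clause_modelT` — the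
  étale-local model `T = {X₀X₁X₂ + X₃² + X₄² = 0}` at the triple point `P` (the `A₁`/`W` models are ✓`SegreConeFull.clause_binomial`).
[cite: Fedder1983, Prop. 1.7, Thm. 1.12 (context)] [folklore computation]
-/

-- single-problem summit: the doubled namespace component is forced
set_option linter.dupNamespace false

noncomputable section

open MvPolynomial

namespace Summit.ResolutionOfSingularities.ResolutionOfSingularities.Theorems.FInjectiveMacaulayfication.SquarefreeCubicTermFull

open Summit.ResolutionOfSingularities.ResolutionOfSingularities.Theorems.FInjectiveMacaulayfication
open AlgebraicGeometry SliceableCentre X2CubicFormFloorCert X2Cubic4VertexFull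

variable (k : Type) [Field k]

/-- `g^n` by the binomial theorem in `X_aX_bX_c` and `W`, written as `Σ X_a^i · cᵢ` with `∂_a cᵢ = 0`. [plumbing] -/
theorem g_pow_eq_sum (n : ℕ) (a b c : Fin 5) (W g : MvPolynomial (Fin 5) k) (hg : g = X a * X b * X c + W) :
    g ^ n = (Finset.range (n + 1)).sum fun i => (n.choose i : MvPolynomial (Fin 5) k) * (X a ^ i * ((X b * X c) ^ i * W ^ (n - i))) := by
  rw [hg, add_pow]
  refine Finset.sum_congr rfl fun i _ => ?_
  rw [mul_assoc (X a) (X b) (X c), mul_pow]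
  ring

/-- ★ **`∂_a^{p−1}(g^{p−1}) = (p−1)!·(X_bX_c)^{p−1}`** for `g = X_aX_bX_c + W`, `∂_aW = 0`, `a ∉ {b, c}`. [folklore computation] -/
theorem iterate_pderiv_g_pow (p : ℕ) (hp : 0 < p) (a b c : Fin 5) (hab : a ≠ b) (hac : a ≠ c) (W g : MvPolynomial (Fin 5) k)
    (hg : g = X a * X b * X c + W) (hWa : pderiv a W = 0) :
    (fun q => pderiv a q)^[p - 1] (g ^ (p - 1)) = (((p - 1).factorial : ℕ) : MvPolynomial (Fin 5) k) * (X b * X c) ^ (p - 1) := by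
  have hc : ∀ i : ℕ, pderiv a ((X b * X c) ^ i * W ^ (p - 1 - i) : MvPolynomial (Fin 5) k) = 0 := fun i => by
    rw [Derivation.leibniz, Derivation.leibniz_pow, Derivation.leibniz_pow, Derivation.leibniz, pderiv_X_of_ne hab.symm, pderiv_X_of_ne hac.symm, hWa]
    simp
  rw [g_pow_eq_sum k (p - 1) a b c W g hg, Nat.sub_add_cancel hp, iterate_pderiv_finset_sum, Finset.sum_eq_single (p - 1)]
  · rw [iterate_pderiv_natCast_mul, X2Cubic4FloorFullCert.iterate_pderiv_X_pow_mul a _ (hc _) (p - 1) (p - 1), Nat.descFactorial_self, Nat.sub_self,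
      Nat.choose_self, pow_zero, pow_zero, one_mul, mul_one]
    push_cast
    ring
  · intro i hi hne
    have hi' : i < p - 1 := lt_of_le_of_ne (Nat.le_sub_one_of_lt (Finset.mem_range.mp hi)) hne
    rw [iterate_pderiv_natCast_mul, X2Cubic4FloorFullCert.iterate_pderiv_X_pow_mul a _ (hc _) (p - 1) i, (Nat.descFactorial_eq_zero_iff_lt).mpr hi']
    simp
  · intro hnot
    exact absurd (Finset.mem_range.mpr (Nat.sub_lt hp Nat.one_pos)) hnot

/-- ★★ **`g^{p−1} ∉ (a₁^p, …, a_m^p)`** for `g = X_aX_bX_c + W` (`a, b, c` distinct, `∂_aW = ∂_bW = ∂_cW = 0`), every prime `p`, every prime `𝔫 = (a₁,…,a_m) ∋ g`.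
[OURS; cite: Fedder1983, Thm. 1.12 (context)] -/
theorem pow_not_mem_span_pow_cubic (p : ℕ) [Fact p.Prime] [CharP k p] (a b c : Fin 5) (hab : a ≠ b) (hac : a ≠ c) (hbc : b ≠ c)
    (W g : MvPolynomial (Fin 5) k) (hg : g = X a * X b * X c + W) (hWa : pderiv a W = 0) (hWb : pderiv b W = 0)
    {m : ℕ} (gen : Fin m → MvPolynomial (Fin 5) k) (h𝔫 : (Ideal.span (Set.range gen)).IsPrime) (hg𝔫 : g ∈ Ideal.span (Set.range gen)) :
    g ^ (p - 1) ∉ Ideal.span (Set.range fun i : Fin m => gen i ^ p) := by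
  intro hgI
  have hp : p.Prime := Fact.out
  haveI := h𝔫
  set 𝔫 := Ideal.span (Set.range gen) with h𝔫def
  set I := Ideal.span (Set.range fun i : Fin m => gen i ^ p) with hIdef
  have hI : I ≤ 𝔫 := by
    rw [hIdef, Ideal.span_le]
    rintro _ ⟨i, rfl⟩
    exact 𝔫.pow_mem_of_mem (Ideal.subset_span ⟨i, rfl⟩) _ hp.pos
  have _ := hg𝔫
  have _ := hWb
  have hfac := factorial_cast_ne_zero k p _ (Nat.sub_lt hp.pos Nat.one_pos)
  -- `∂_a^{p−1}`: `(p−1)!·(X_bX_c)^{p−1} ∈ I`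
  have h1 := iterate_derivation_mem_span_pow p k gen (pderiv a : Derivation k (MvPolynomial (Fin 5) k) (MvPolynomial (Fin 5) k)) (p - 1) hgI
  have h1' : (fun q => (pderiv a : Derivation k (MvPolynomial (Fin 5) k) (MvPolynomial (Fin 5) k)) q)^[p - 1] (g ^ (p - 1)) =
      (((p - 1).factorial : ℕ) : MvPolynomial (Fin 5) k) * (X b * X c) ^ (p - 1) := iterate_pderiv_g_pow k p hp.pos a b c hab hac W g hg hWa
  rw [h1'] at h1
  have hXbc : ((X b * X c : MvPolynomial (Fin 5) k)) ^ (p - 1) ∈ I := mem_of_natCast_mul_mem k hfac I _ h1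
  -- `∂_b^{p−1}`: `(p−1)!·X_c^{p−1} ∈ I`
  rw [mul_pow] at hXbc
  have h2 := iterate_derivation_mem_span_pow p k gen (pderiv b : Derivation k (MvPolynomial (Fin 5) k) (MvPolynomial (Fin 5) k)) (p - 1) hXbc
  have h2' : (fun q => (pderiv b : Derivation k (MvPolynomial (Fin 5) k) (MvPolynomial (Fin 5) k)) q)^[p - 1]
      ((X b : MvPolynomial (Fin 5) k) ^ (p - 1) * (X c : MvPolynomial (Fin 5) k) ^ (p - 1)) =
      (((p - 1).factorial : ℕ) : MvPolynomial (Fin 5) k) * (X c : MvPolynomial (Fin 5) k) ^ (p - 1) := by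
    have hcst : pderiv b ((X c : MvPolynomial (Fin 5) k) ^ (p - 1)) = 0 := by
      rw [Derivation.leibniz_pow, pderiv_X_of_ne hbc.symm]; simp
    have := X2Cubic4FloorFullCert.iterate_pderiv_X_pow_mul b ((X c : MvPolynomial (Fin 5) k) ^ (p - 1)) hcst (p - 1) (p - 1)
    rw [Nat.descFactorial_self, Nat.sub_self, pow_zero, one_mul] at this
    exact this
  rw [h2'] at h2
  have hXc : (X c : MvPolynomial (Fin 5) k) ^ (p - 1) ∈ I := mem_of_natCast_mul_mem k hfac I _ h2
  -- `∂_c^{p−1}`: `(p−1)! ∈ I`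
  have h3 := iterate_derivation_mem_span_pow p k gen (pderiv c : Derivation k (MvPolynomial (Fin 5) k) (MvPolynomial (Fin 5) k)) (p - 1) hXc
  have h3' : (fun q => (pderiv c : Derivation k (MvPolynomial (Fin 5) k) (MvPolynomial (Fin 5) k)) q)^[p - 1] ((X c : MvPolynomial (Fin 5) k) ^ (p - 1)) =
      (((p - 1).factorial : ℕ) : MvPolynomial (Fin 5) k) := by
    have := X2Cubic4FloorFullCert.iterate_pderiv_X_pow_mul c (1 : MvPolynomial (Fin 5) k) (by simp) (p - 1) (p - 1)
    rw [mul_one, Nat.descFactorial_self, Nat.sub_self, pow_zero, mul_one, mul_one] at this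
    exact this
  rw [h3'] at h3
  have hone : (1 : MvPolynomial (Fin 5) k) ∈ I := mem_of_natCast_mul_mem k hfac I 1 (by rwa [mul_one])
  exact h𝔫.ne_top ((Ideal.eq_top_iff_one _).mpr (hI hone))

/-- ★★ **THE FULL CLAUSE AT EVERY CLOSED POINT OF `k[X]/(X_aX_bX_c + W)`** (`a, b, c` distinct, `∂_aW = ∂_bW = 0`, `g ≠ 0`), every prime `p`: every parameter
ideal of the local ring at a maximal ideal is generated by a weakly regular sequence and is Frobenius closed. [OURS · assembly; cite: Fedder1983, Prop. 1.7, Thm. 1.12] -/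
theorem clause_cubic (p : ℕ) [Fact p.Prime] [CharP k p] (a b c : Fin 5) (hab : a ≠ b) (hac : a ≠ c) (hbc : b ≠ c) (W g : MvPolynomial (Fin 5) k)
    (hg : g = X a * X b * X c + W) (hWa : pderiv a W = 0) (hWb : pderiv b W = 0) (hg0 : g ≠ 0)
    (Q : Ideal (MvPolynomial (Fin 5) k ⧸ Ideal.span {g})) [Q.IsMaximal] :
    ∀ d : ℕ, ringKrullDim (Localization.AtPrime Q) = d → ∀ s : Fin d → Localization.AtPrime Q,
      (Ideal.span (Set.range s)).radical.IsMaximal →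
        RingTheory.Sequence.IsWeaklyRegular (Localization.AtPrime Q) (List.ofFn s) ∧
        ∀ y : Localization.AtPrime Q, (∃ e : ℕ, y ^ p ^ e ∈ Ideal.span
          ((fun z : Localization.AtPrime Q => z ^ p ^ e) ''
            (Ideal.span (Set.range s) : Set (Localization.AtPrime Q)))) → y ∈ Ideal.span (Set.range s) := by
  obtain ⟨m, gen, hgen⟩ := Submodule.fg_iff_exists_fin_generating_family.mp (IsNoetherian.noetherian (Q.comap (Ideal.Quotient.mk (Ideal.span {g}))))
  have hP : Q.comap (Ideal.Quotient.mk (Ideal.span {g})) = Ideal.span (Set.range gen) := hgen.symm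
  have hprime : (Ideal.span (Set.range gen)).IsPrime := by rw [← hP]; exact Ideal.comap_isPrime _ Q
  have hgm : g ∈ Ideal.span (Set.range gen) := by
    rw [← hP, Ideal.mem_comap, Ideal.Quotient.eq_zero_iff_mem.mpr (Ideal.mem_span_singleton_self g)]
    exact Q.zero_mem
  exact FedderAtMaximalIdeal.stub_fedderAtMaximalIdeal p k 5 m gen g Q hP hg0 (pow_not_mem_span_pow_cubic k p a b c hab hac hbc W g hg hWa hWb gen hprime hgm)

/-- **`FullCl` at every closed point of `Spec k[X]/(X_aX_bX_c + W)`** when `g` is prime. [OURS · assembly] -/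
theorem fullCl_stalk_cubic (p : ℕ) [Fact p.Prime] [CharP k p] (a b c : Fin 5) (hab : a ≠ b) (hac : a ≠ c) (hbc : b ≠ c) (W g : MvPolynomial (Fin 5) k)
    (hg : g = X a * X b * X c + W) (hWa : pderiv a W = 0) (hWb : pderiv b W = 0) (hprime : Prime g)
    (y : Spec (.of (MvPolynomial (Fin 5) k ⧸ Ideal.span {g}))) (hy : y.asIdeal.IsMaximal) :
    FullCl p ((Spec (.of (MvPolynomial (Fin 5) k ⧸ Ideal.span {g}))).presheaf.stalk y) := by
  haveI := (Ideal.span_singleton_prime hprime.ne_zero).mpr hprime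
  haveI : IsDomain (MvPolynomial (Fin 5) k ⧸ Ideal.span {g}) := Ideal.Quotient.isDomain _
  haveI := hy
  haveI : IsDomain (Localization.AtPrime y.asIdeal) :=
    IsLocalization.isDomain_of_le_nonZeroDivisors _ y.asIdeal.primeCompl_le_nonZeroDivisors
  have hloc : FullCl p (Localization.AtPrime y.asIdeal) :=
    ⟨inferInstance, clause_cubic k p a b c hab hac hbc W g hg hWa hWb hprime.ne_zero y.asIdeal⟩
  exact WFixAtNonClosedDimTwo.fullCl_of_ringEquiv p (Spec.stalkIso (.of _) y).commRingCatIsoToRingEquiv.symm hloc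

/-! ## The (C1)-bed models of `Lines/T-instance7-C1.md` -/

/-- **The tangent cone `C = {X₀X₁X₂ + X₃²X₄ = 0}` of the (C1) bed is FULL (clause form) at every closed point, every prime `p`.** [OURS · application] -/
theorem clause_tangentCone (p : ℕ) [Fact p.Prime] [CharP k p] (g : MvPolynomial (Fin 5) k) (hg : g = X 0 * X 1 * X 2 + X 3 ^ 2 * X 4)
    (Q : Ideal (MvPolynomial (Fin 5) k ⧸ Ideal.span {g})) [Q.IsMaximal] :
    ∀ d : ℕ, ringKrullDim (Localization.AtPrime Q) = d → ∀ s : Fin d → Localization.AtPrime Q,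
      (Ideal.span (Set.range s)).radical.IsMaximal →
        RingTheory.Sequence.IsWeaklyRegular (Localization.AtPrime Q) (List.ofFn s) ∧
        ∀ y : Localization.AtPrime Q, (∃ e : ℕ, y ^ p ^ e ∈ Ideal.span
          ((fun z : Localization.AtPrime Q => z ^ p ^ e) ''
            (Ideal.span (Set.range s) : Set (Localization.AtPrime Q)))) → y ∈ Ideal.span (Set.range s) := by
  refine clause_cubic k p 0 1 2 (by decide) (by decide) (by decide) (X 3 ^ 2 * X 4) g hg ?_ ?_ ?_ Q
  · rw [Derivation.leibniz, Derivation.leibniz_pow, pderiv_X_of_ne (show (3 : Fin 5) ≠ 0 by decide), pderiv_X_of_ne (show (4 : Fin 5) ≠ 0 by decide)]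
    simp
  · rw [Derivation.leibniz, Derivation.leibniz_pow, pderiv_X_of_ne (show (3 : Fin 5) ≠ 1 by decide), pderiv_X_of_ne (show (4 : Fin 5) ≠ 1 by decide)]
    simp
  · intro h0
    have := congrArg (MvPolynomial.eval (fun j : Fin 5 => if j = 0 ∨ j = 1 ∨ j = 2 then (1 : k) else 0)) h0
    rw [hg] at this
    simp at this

/-- **The étale-local model `T = {X₀X₁X₂ + X₃² + X₄² = 0}` of the (C1) bed at the triple point `P` is FULL (clause form) at every closed point, every
prime `p`.** [OURS · application] -/
theorem clause_modelT (p : ℕ) [Fact p.Prime] [CharP k p] (g : MvPolynomial (Fin 5) k) (hg : g = X 0 * X 1 * X 2 + (X 3 ^ 2 + X 4 ^ 2))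
    (Q : Ideal (MvPolynomial (Fin 5) k ⧸ Ideal.span {g})) [Q.IsMaximal] :
    ∀ d : ℕ, ringKrullDim (Localization.AtPrime Q) = d → ∀ s : Fin d → Localization.AtPrime Q,
      (Ideal.span (Set.range s)).radical.IsMaximal →
        RingTheory.Sequence.IsWeaklyRegular (Localization.AtPrime Q) (List.ofFn s) ∧
        ∀ y : Localization.AtPrime Q, (∃ e : ℕ, y ^ p ^ e ∈ Ideal.span
          ((fun z : Localization.AtPrime Q => z ^ p ^ e) ''
            (Ideal.span (Set.range s) : Set (Localization.AtPrime Q)))) → y ∈ Ideal.span (Set.range s) := by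
  refine clause_cubic k p 0 1 2 (by decide) (by decide) (by decide) (X 3 ^ 2 + X 4 ^ 2) g hg ?_ ?_ ?_ Q
  · rw [map_add, Derivation.leibniz_pow, Derivation.leibniz_pow, pderiv_X_of_ne (show (3 : Fin 5) ≠ 0 by decide),
      pderiv_X_of_ne (show (4 : Fin 5) ≠ 0 by decide)]
    simp
  · rw [map_add, Derivation.leibniz_pow, Derivation.leibniz_pow, pderiv_X_of_ne (show (3 : Fin 5) ≠ 1 by decide),
      pderiv_X_of_ne (show (4 : Fin 5) ≠ 1 by decide)]
    simp
  · intro h0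
    have := congrArg (MvPolynomial.eval (fun j : Fin 5 => if j = 0 ∨ j = 1 ∨ j = 2 then (1 : k) else 0)) h0
    rw [hg] at this
    simp at this

end Summit.ResolutionOfSingularities.ResolutionOfSingularities.Theorems.FInjectiveMacaulayfication.SquarefreeCubicTermFull

end
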